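import Summits.AtomisticToContinuum.HydrodynamicLimit.Theorems.InformationPercolationEngineChaosClosesEulerEntropyBalanceB
import Summits.AtomisticToContinuum.HydrodynamicLimit.Theorems.InformationPercolationEngineChaosClosesEulerWindowedInvariance
import Summits.AtomisticToContinuum.HydrodynamicLimit.Theorems.InformationPercolationEngineChaosClosesEulerReductionFields
import Summits.AtomisticToContinuum.HydrodynamicLimit.Theorems.InformationPercolationEngineChaosClosesEulerLocalEquilibriumFromDissipationA
import HarnessLib

/-!
# Windowed entropy balance — helper C: the smoothed cone law and the coarse-grained entropy

Helper file for the registered stub `stub_windowedEntropyBalance` of the line `empirical-h-theorem`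
(crux `InformationPercolationEngine.ChaosClosesEuler`, stmt-AtomisticToContinuum-15141).

WHAT. The configuration-level objects of the windowed entropy balance, DEFINITIONALLY the `let`s
of the registered statement: the `δ`-smoothed `r`-cone velocity law of a configuration
`g_x(v) = ∫ b_r(q.x, x) φ_δ(v − q.v) dμ_w(q) = (N+1)⁻¹ Σᵢ b_r(xᵢ, x) φ_δ(v − vᵢ)` (`gC`), the
mollified floored log-density `Λ̃_x(v) = ∫ φ_δ(v − u) ℓ_{y₀(u)}(g_x(u)) du` (`LamC`), the
coarse-grained entropy density `S(x) = ∫ 𝔰_{y₀(v)}(g_x(v)) dv` (`SC`) and the windowed functional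
`𝒮(w) = ∫ₓ b_r(x, x₀) h(ρ_r(x)) S(x) dx` (`FS`). We prove the particle-sum formula, `0 ≤ g ≤ M_g`
(`M_g = 3/(πr³) φ_δ(0)`), joint continuity, the velocity-integrability of `𝔰(g)`, `ℓ(g) φ_δ` and
of the domination `g · A`, and the a-priori bounds
`|S(x)| ≤ C_S (1 + E/(N+1))`, `|𝒮(w)| ≤ (3/(πr³)) C_h C_S (1 + E/(N+1))` (`abs_SC_le`, `abs_FS_le`;
mass of the cone `≤ 3/(πr³)`, the linear Gaussian bound of helper B and `Σ|vᵢ| ≤ (N+1)/2 + E`).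

References: L. Boltzmann (1872); folklore (coarse-grained `H`-functional).
-/

noncomputable section

namespace Summit.AtomisticToContinuum.HydrodynamicLimit.Theorems.ChaosClosesEulerEntropyBalance

open scoped BigOperators Topology Classical MeasureTheory ENNReal InnerProductSpace
open Filter Set MeasureTheory ProbabilityTheory
open Literature.MathematicalPhysics.KineticTheory
open Literature.Analysis.FluidPDE
open Summit.AtomisticToContinuum.HydrodynamicLimit.Theorems.LocalSecondLawNegative (cone rhoC cone_nonneg
  continuous_cone rhoC_nonneg continuous_rhoC)
open Summit.AtomisticToContinuum.HydrodynamicLimit.Theorems.ChaosClosesEulerReduction (rhoC_le)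
open Summit.AtomisticToContinuum.HydrodynamicLimit.Theorems.LocalSecondLawLedger.L (rhoC_eq_sum)
open Summit.AtomisticToContinuum.HydrodynamicLimit.Theorems.ChaosClosesEulerCollisionInvariance (sum_norm_vel_le)
open Summit.AtomisticToContinuum.HydrodynamicLimit.Theorems.ChaosClosesEulerWindowedInvariance (cone_nonneg_le)

variable {N : ℕ}

/-! ## §1 Definitions -/

/-- The sup of the smoothed cone law: `M_g = (3/(πr³)) φ_δ(0)`. [folklore] -/
def Mg (r δ : ℝ) : ℝ := 3 / (Real.pi * r ^ 3) * phiMax δ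

/-- The `δ`-smoothed `r`-cone velocity law `g_x(v) = ∫ b_r(q.x, x) φ_δ(v − q.v) dμ_w(q)` of a
configuration (the `g` of the registered statement). [folklore] -/
def gC (r δ : ℝ) (w : Config (N + 1) (Fin 3) T3) (x : T3) (v : V3) : ℝ :=
  ∫ q, cone r q.1 x * phi δ (v - q.2) ∂(empiricalMeasure w)

/-- The mollified floored log-density `Λ̃_x(v) = ∫ φ_δ(v − u) ℓ_{y₀(u)}(g_x(u)) du` (the `Λt` of the
registered statement). [folklore] -/
def LamC (r δ K : ℝ) (w : Config (N + 1) (Fin 3) T3) (x : T3) (v : V3) : ℝ :=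
  ∫ u, phi δ (v - u) * flog (yfl K u) (gC r δ w x u)

/-- The coarse-grained entropy density of the cone at `x`: `S(x) = ∫ 𝔰_{y₀(v)}(g_x(v)) dv` (minus
the floored entropy of `g_x`). [folklore] -/
def SC (r δ K : ℝ) (w : Config (N + 1) (Fin 3) T3) (x : T3) : ℝ :=
  ∫ v, sK (yfl K v) (gC r δ w x v)

/-- The windowed coarse-grained entropy functional `𝒮(w) = ∫ₓ b_r(x, x₀) h(ρ_r(x)) S(x) dx`.
[folklore] -/
def FS (r δ K : ℝ) (h : ℝ → ℝ) (x₀ : T3) (w : Config (N + 1) (Fin 3) T3) : ℝ :=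
  ∫ x, cone r x x₀ * h (rhoC r w x) * SC r δ K w x

/-- The constant of the entropy sup bound: `C_S = (3/(πr³))(|K| + |log M_g| + 8δ + 8)`. [folklore] -/
def CS (r δ K : ℝ) : ℝ := 3 / (Real.pi * r ^ 3) * (|K| + |Real.log (Mg r δ)| + 8 * δ + 8)

/-! ## §2 The smoothed cone law -/

/-- `M_g > 0`. [folklore] -/
theorem Mg_pos {r δ : ℝ} (hr : 0 < r) (hδ : 0 < δ) : 0 < Mg r δ := by
  unfold Mg; exact mul_pos (by positivity) (phiMax_pos hδ)

/-- **Particle-sum formula**: `g_x(v) = (N+1)⁻¹ Σᵢ b_r(xᵢ, x) φ_δ(v − vᵢ)`. [folklore] -/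
theorem gC_eq_sum (r δ : ℝ) (w : Config (N + 1) (Fin 3) T3) (x : T3) (v : V3) :
    gC r δ w x v = ((N + 1 : ℕ) : ℝ)⁻¹ * ∑ i, cone r (w i).1 x * phi δ (v - (w i).2) := by
  unfold gC; rw [integral_empiricalMeasure]

/-- `g ≥ 0`. [folklore] -/
theorem gC_nonneg {r δ : ℝ} (hr : 0 < r) (hδ : 0 < δ) (w : Config (N + 1) (Fin 3) T3) (x : T3) (v : V3) :
    0 ≤ gC r δ w x v := by
  rw [gC_eq_sum]
  exact mul_nonneg (by positivity)
    (Finset.sum_nonneg fun i _ => mul_nonneg (cone_nonneg hr _ _) (phi_nonneg hδ _))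

/-- `g ≤ M_g`. [folklore] -/
theorem gC_le_Mg {r δ : ℝ} (hr : 0 < r) (hδ : 0 < δ) (w : Config (N + 1) (Fin 3) T3) (x : T3) (v : V3) :
    gC r δ w x v ≤ Mg r δ := by
  rw [gC_eq_sum]
  have hle : ∀ i, cone r (w i).1 x * phi δ (v - (w i).2) ≤ 3 / (Real.pi * r ^ 3) * phiMax δ := fun i =>
    mul_le_mul ((cone_nonneg_le hr _ _).2) (phi_le_phiMax δ _) (phi_nonneg hδ _) (by positivity)
  have hN : (0 : ℝ) < ((N + 1 : ℕ) : ℝ) := by positivity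
  calc ((N + 1 : ℕ) : ℝ)⁻¹ * ∑ i, cone r (w i).1 x * phi δ (v - (w i).2)
      ≤ ((N + 1 : ℕ) : ℝ)⁻¹ * ∑ _i : Fin (N + 1), 3 / (Real.pi * r ^ 3) * phiMax δ :=
        mul_le_mul_of_nonneg_left (Finset.sum_le_sum fun i _ => hle i) (by positivity)
    _ = Mg r δ := by
        rw [Finset.sum_const, Finset.card_univ, Fintype.card_fin, nsmul_eq_mul, ← mul_assoc,
          inv_mul_cancel₀ hN.ne', one_mul, Mg]

/-- `|g| ≤ M_g`. [folklore] -/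
theorem abs_gC_le {r δ : ℝ} (hr : 0 < r) (hδ : 0 < δ) (w : Config (N + 1) (Fin 3) T3) (x : T3) (v : V3) :
    |gC r δ w x v| ≤ Mg r δ := by
  rw [abs_of_nonneg (gC_nonneg hr hδ w x v)]; exact gC_le_Mg hr hδ w x v

/-- `g` is jointly continuous in `(x, v)`. [folklore] -/
theorem continuous_gC₂ (r δ : ℝ) (w : Config (N + 1) (Fin 3) T3) :
    Continuous fun p : T3 × V3 => gC r δ w p.1 p.2 := by
  have h : (fun p : T3 × V3 => gC r δ w p.1 p.2) =
      fun p => ((N + 1 : ℕ) : ℝ)⁻¹ * ∑ i, cone r (w i).1 p.1 * phi δ (p.2 - (w i).2) := by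
    funext p; exact gC_eq_sum r δ w p.1 p.2
  rw [h]
  refine continuous_const.mul (continuous_finsetSum _ fun i _ => ?_)
  exact ((continuous_cone r (w i).1).comp continuous_fst).mul
    ((continuous_phi δ).comp (continuous_snd.sub continuous_const))

/-- `g_x` is continuous in `v`. [folklore] -/
theorem continuous_gC (r δ : ℝ) (w : Config (N + 1) (Fin 3) T3) (x : T3) : Continuous (gC r δ w x) := by
  have h : gC r δ w x = fun v => ((N + 1 : ℕ) : ℝ)⁻¹ * ∑ i, cone r (w i).1 x * phi δ (v - (w i).2) := by
    funext v; exact gC_eq_sum r δ w x v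
  rw [h]
  refine continuous_const.mul (continuous_finsetSum _ fun i _ => ?_)
  exact continuous_const.mul ((continuous_phi δ).comp (continuous_id.sub continuous_const))

/-! ## §3 Velocity integrability -/

/-- The entropic weight is dominated by the envelope, in absolute value. [folklore] -/
theorem abs_Aw_le_env (K M : ℝ) (v : V3) : |Aw K M v| ≤ (|K| + |Real.log M| + 6) * (1 + ‖v‖ ^ 2) ^ 2 := by
  rw [abs_of_nonneg (zero_le_two.trans (two_le_Aw K M v))]; exact Aw_le_env K M v

/-- The domination `v ↦ (N+1)⁻¹ Σᵢ b_r(xᵢ,x) φ_δ(v − vᵢ) A(v) = g_x(v) A(v)` is integrable. [folklore] -/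
theorem integrable_gC_mul_Aw {r δ : ℝ} (hδ : 0 < δ) (K M : ℝ) (w : Config (N + 1) (Fin 3) T3) (x : T3) :
    Integrable (fun v => gC r δ w x v * Aw K M v) := by
  have h : (fun v => gC r δ w x v * Aw K M v) =
      fun v => ∑ i, ((N + 1 : ℕ) : ℝ)⁻¹ * cone r (w i).1 x * (phi δ (v - (w i).2) * Aw K M v) := by
    funext v
    rw [gC_eq_sum, Finset.mul_sum, Finset.sum_mul]
    exact Finset.sum_congr rfl fun i _ => by ring
  rw [h]
  refine integrable_finsetSum _ fun i _ => Integrable.const_mul ?_ _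
  exact integrable_phi_sub_mul hδ (continuous_Aw K M).measurable (abs_Aw_le_env K M) _

/-- `v ↦ 𝔰_{y₀(v)}(g_x(v))` is measurable. [folklore] -/
theorem measurable_sK_gC (r δ K : ℝ) (w : Config (N + 1) (Fin 3) T3) (x : T3) :
    Measurable fun v => sK (yfl K v) (gC r δ w x v) :=
  measurable_sK₂.comp ((continuous_yfl K).measurable.prodMk (continuous_gC r δ w x).measurable)

/-- `v ↦ ℓ_{y₀(v)}(g_x(v))` is measurable. [folklore] -/
theorem measurable_flog_gC (r δ K : ℝ) (w : Config (N + 1) (Fin 3) T3) (x : T3) :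
    Measurable fun v => flog (yfl K v) (gC r δ w x v) :=
  measurable_flog₂.comp ((continuous_yfl K).measurable.prodMk (continuous_gC r δ w x).measurable)

/-- `|𝔰_{y₀(v)}(g_x(v))| ≤ g_x(v) A(v)`. [folklore] -/
theorem abs_sK_gC_le {r δ : ℝ} (hr : 0 < r) (hδ : 0 < δ) (K : ℝ) (w : Config (N + 1) (Fin 3) T3) (x : T3)
    (v : V3) : |sK (yfl K v) (gC r δ w x v)| ≤ gC r δ w x v * Aw K (Mg r δ) v := by
  rw [mul_comm]; exact abs_sK_yfl_le K v (gC_nonneg hr hδ w x v) (gC_le_Mg hr hδ w x v)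

/-- `|ℓ_{y₀(v)}(g_x(v))| ≤ A(v)`. [folklore] -/
theorem abs_flog_gC_le {r δ : ℝ} (hr : 0 < r) (hδ : 0 < δ) (K : ℝ) (w : Config (N + 1) (Fin 3) T3) (x : T3)
    (v : V3) : |flog (yfl K v) (gC r δ w x v)| ≤ Aw K (Mg r δ) v :=
  abs_flog_yfl_le K v (gC_nonneg hr hδ w x v) (gC_le_Mg hr hδ w x v)

/-- `|ℓ_{y₀(v)}(g_x(v))|` is dominated by the envelope. [folklore] -/
theorem abs_flog_gC_le_env {r δ : ℝ} (hr : 0 < r) (hδ : 0 < δ) (K : ℝ) (w : Config (N + 1) (Fin 3) T3)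
    (x : T3) (v : V3) :
    |flog (yfl K v) (gC r δ w x v)| ≤ (|K| + |Real.log (Mg r δ)| + 6) * (1 + ‖v‖ ^ 2) ^ 2 :=
  (abs_flog_gC_le hr hδ K w x v).trans (Aw_le_env K _ v)

/-- **The entropy density integrand is integrable in `v`.** [folklore] -/
theorem integrable_sK_gC {r δ : ℝ} (hr : 0 < r) (hδ : 0 < δ) (K : ℝ) (w : Config (N + 1) (Fin 3) T3) (x : T3) :
    Integrable fun v => sK (yfl K v) (gC r δ w x v) :=
  (integrable_gC_mul_Aw hδ K (Mg r δ) w x).mono' (measurable_sK_gC r δ K w x).aestronglyMeasurable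
    (Eventually.of_forall fun v => by rw [Real.norm_eq_abs]; exact abs_sK_gC_le hr hδ K w x v)

/-- **The mark integrand `φ_δ(· − a) ℓ(g_x)` is integrable in `u`.** [folklore] -/
theorem integrable_phi_mul_flog_gC {r δ : ℝ} (hr : 0 < r) (hδ : 0 < δ) (K : ℝ) (w : Config (N + 1) (Fin 3) T3)
    (x : T3) (a : V3) : Integrable fun u => phi δ (u - a) * flog (yfl K u) (gC r δ w x u) :=
  integrable_phi_sub_mul hδ (measurable_flog_gC r δ K w x) (abs_flog_gC_le_env hr hδ K w x) a

/-- `Λ̃_x(a)` as an integral against the translate `φ_δ(· − a)`. [folklore] -/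
theorem LamC_eq {r δ : ℝ} (K : ℝ) (w : Config (N + 1) (Fin 3) T3) (x : T3) (a : V3) :
    LamC r δ K w x a = ∫ u, phi δ (u - a) * flog (yfl K u) (gC r δ w x u) := by
  unfold LamC
  refine integral_congr_ae (Eventually.of_forall fun u => ?_)
  dsimp only
  rw [phi_sub_comm]

/-- A uniform bound for the mollified floored log-density:
`|Λ̃_x(a)| ≤ (|K| + |log M_g| + 6) c₄(δ) (1 + |a|⁴)`. [folklore] -/
theorem abs_LamC_le {r δ : ℝ} (hr : 0 < r) (hδ : 0 < δ) (K : ℝ) (w : Config (N + 1) (Fin 3) T3) (x : T3)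
    (a : V3) : |LamC r δ K w x a| ≤ (|K| + |Real.log (Mg r δ)| + 6) * (c4 δ * (1 + ‖a‖ ^ 4)) := by
  rw [LamC_eq]
  exact abs_integral_phi_sub_mul_le hδ (abs_flog_gC_le_env hr hδ K w x) a

/-! ## §4 The a-priori bounds of `S` and `𝒮` -/

/-- The domination integrates to at most
`(3/(πr³))((|K| + |log M| + 2 + 8δ) + 4 (N+1)⁻¹ Σᵢ |vᵢ|)`. [folklore] -/
theorem integral_gC_mul_Aw_le {r δ : ℝ} (hr : 0 < r) (hδ : 0 < δ) (K M : ℝ) (w : Config (N + 1) (Fin 3) T3)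
    (x : T3) :
    ∫ v, gC r δ w x v * Aw K M v ≤ 3 / (Real.pi * r ^ 3) *
      ((|K| + |Real.log M| + 2 + 8 * δ) + 4 * (((N + 1 : ℕ) : ℝ)⁻¹ * ∑ i, ‖(w i).2‖)) := by
  have hN : (0 : ℝ) < ((N + 1 : ℕ) : ℝ) := by positivity
  have h : (fun v => gC r δ w x v * Aw K M v) =
      fun v => ∑ i, ((N + 1 : ℕ) : ℝ)⁻¹ * cone r (w i).1 x * (phi δ (v - (w i).2) * Aw K M v) := by
    funext v
    rw [gC_eq_sum, Finset.mul_sum, Finset.sum_mul]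
    exact Finset.sum_congr rfl fun i _ => by ring
  have hint : ∀ i, Integrable fun v => phi δ (v - (w i).2) * Aw K M v := fun i =>
    integrable_phi_sub_mul hδ (continuous_Aw K M).measurable (abs_Aw_le_env K M) _
  rw [h, integral_finsetSum _ fun i _ => (hint i).const_mul _]
  have hterm : ∀ i, ∫ v, ((N + 1 : ℕ) : ℝ)⁻¹ * cone r (w i).1 x * (phi δ (v - (w i).2) * Aw K M v) ≤
      ((N + 1 : ℕ) : ℝ)⁻¹ * (3 / (Real.pi * r ^ 3)) * (|K| + |Real.log M| + 2 + 8 * δ + 4 * ‖(w i).2‖) := by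
    intro i
    rw [integral_const_mul]
    have h1 := integral_phi_Aw_le hδ K M (w i).2
    have h2 : 0 ≤ ∫ v, phi δ (v - (w i).2) * Aw K M v :=
      integral_nonneg fun v => mul_nonneg (phi_nonneg hδ _) (zero_le_two.trans (two_le_Aw K M v))
    have h3 : ((N + 1 : ℕ) : ℝ)⁻¹ * cone r (w i).1 x ≤ ((N + 1 : ℕ) : ℝ)⁻¹ * (3 / (Real.pi * r ^ 3)) :=
      mul_le_mul_of_nonneg_left ((cone_nonneg_le hr _ _).2) (by positivity)
    have h4 : 0 ≤ ((N + 1 : ℕ) : ℝ)⁻¹ * cone r (w i).1 x := mul_nonneg (by positivity) (cone_nonneg hr _ _)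
    calc ((N + 1 : ℕ) : ℝ)⁻¹ * cone r (w i).1 x * ∫ v, phi δ (v - (w i).2) * Aw K M v
        ≤ ((N + 1 : ℕ) : ℝ)⁻¹ * (3 / (Real.pi * r ^ 3)) * (|K| + |Real.log M| + 2 + 4 * ‖(w i).2‖ + 8 * δ) :=
          mul_le_mul h3 h1 h2 (by positivity)
      _ = _ := by ring
  calc ∑ i, ∫ v, ((N + 1 : ℕ) : ℝ)⁻¹ * cone r (w i).1 x * (phi δ (v - (w i).2) * Aw K M v)
      ≤ ∑ i, ((N + 1 : ℕ) : ℝ)⁻¹ * (3 / (Real.pi * r ^ 3)) * (|K| + |Real.log M| + 2 + 8 * δ + 4 * ‖(w i).2‖) :=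
        Finset.sum_le_sum fun i _ => hterm i
    _ = 3 / (Real.pi * r ^ 3) * ((|K| + |Real.log M| + 2 + 8 * δ) + 4 * (((N + 1 : ℕ) : ℝ)⁻¹ * ∑ i, ‖(w i).2‖)) := by
        rw [← Finset.mul_sum, Finset.sum_add_distrib, Finset.sum_const, Finset.card_univ, Fintype.card_fin,
          nsmul_eq_mul, ← Finset.mul_sum]
        field_simp

/-- **Sup bound of the coarse-grained entropy density**: `|S(x)| ≤ C_S (1 + E(w)/(N+1))`. [folklore] -/
theorem abs_SC_le {r δ : ℝ} (hr : 0 < r) (hδ : 0 < δ) (K : ℝ) (w : Config (N + 1) (Fin 3) T3) (x : T3) :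
    |SC r δ K w x| ≤ CS r δ K * (1 + configEnergy w / (N + 1 : ℝ)) := by
  have hN : (0 : ℝ) < (N : ℝ) + 1 := by positivity
  have h1 : |SC r δ K w x| ≤ ∫ v, gC r δ w x v * Aw K (Mg r δ) v := by
    unfold SC
    refine (abs_integral_le_integral_abs).trans ?_
    exact integral_mono_of_nonneg (Eventually.of_forall fun v => abs_nonneg _) (integrable_gC_mul_Aw hδ K _ w x)
      (Eventually.of_forall fun v => abs_sK_gC_le hr hδ K w x v)
  have h2 := integral_gC_mul_Aw_le hr hδ K (Mg r δ) w x
  have h3 := sum_norm_vel_le w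
  have h4 : ((N + 1 : ℕ) : ℝ)⁻¹ * ∑ i, ‖(w i).2‖ ≤ 1 / 2 + configEnergy w / (N + 1 : ℝ) := by
    push_cast at h3 ⊢
    rw [inv_mul_le_iff₀ hN]
    have : ((N : ℝ) + 1) * (1 / 2 + configEnergy w / ((N : ℝ) + 1)) = ((N : ℝ) + 1) / 2 + configEnergy w := by
      field_simp
    linarith
  have hE : 0 ≤ configEnergy w / (N + 1 : ℝ) := by unfold configEnergy; positivity
  have hc : 0 ≤ 3 / (Real.pi * r ^ 3) := by positivity
  have hA : 0 ≤ |K| + |Real.log (Mg r δ)| := by positivity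
  calc |SC r δ K w x| ≤ 3 / (Real.pi * r ^ 3) *
        ((|K| + |Real.log (Mg r δ)| + 2 + 8 * δ) + 4 * (((N + 1 : ℕ) : ℝ)⁻¹ * ∑ i, ‖(w i).2‖)) := h1.trans h2
    _ ≤ 3 / (Real.pi * r ^ 3) * ((|K| + |Real.log (Mg r δ)| + 2 + 8 * δ) + 4 * (1 / 2 + configEnergy w / (N + 1 : ℝ))) := by
        gcongr
    _ ≤ CS r δ K * (1 + configEnergy w / (N + 1 : ℝ)) := by
        unfold CS
        nlinarith [mul_nonneg hc hE, mul_nonneg (mul_nonneg hc hE) hA, mul_nonneg (mul_nonneg hc hE) hδ.le]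

/-- **Sup bound of the windowed functional**: `|𝒮(w)| ≤ (3/(πr³)) C_h C_S (1 + E(w)/(N+1))`
(no measurability needed: the torus has unit volume). [folklore] -/
theorem abs_FS_le {r δ : ℝ} (hr : 0 < r) (hδ : 0 < δ) (K : ℝ) {h : ℝ → ℝ} {Ch : ℝ} (hhb : ∀ a, |h a| ≤ Ch)
    (x₀ : T3) (w : Config (N + 1) (Fin 3) T3) :
    |FS r δ K h x₀ w| ≤ 3 / (Real.pi * r ^ 3) * Ch * CS r δ K * (1 + configEnergy w / (N + 1 : ℝ)) := by
  have hCh : 0 ≤ Ch := (abs_nonneg _).trans (hhb 0)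
  have hpt : ∀ x, ‖cone r x x₀ * h (rhoC r w x) * SC r δ K w x‖ ≤
      3 / (Real.pi * r ^ 3) * Ch * (CS r δ K * (1 + configEnergy w / (N + 1 : ℝ))) := fun x => by
    rw [Real.norm_eq_abs, abs_mul, abs_mul, abs_of_nonneg (cone_nonneg hr _ _)]
    exact mul_le_mul (mul_le_mul ((cone_nonneg_le hr _ _).2) (hhb _) (abs_nonneg _) (by positivity))
      (abs_SC_le hr hδ K w x) (abs_nonneg _) (by positivity)
  have h := norm_integral_le_of_norm_le_const (μ := (volume : Measure T3)) (Eventually.of_forall hpt)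
  rw [probReal_univ, mul_one, Real.norm_eq_abs] at h
  unfold FS
  linarith

/-- `C_S > 0`. [folklore] -/
theorem CS_pos {r δ : ℝ} (hr : 0 < r) (hδ : 0 < δ) (K : ℝ) : 0 < CS r δ K := by
  unfold CS; positivity

/-- REGISTERED SUB-GOAL `stub_windowedEntropyBalanceC` of the line `empirical-h-theorem` (crux
stmt-AtomisticToContinuum-15141): the `δ`-smoothed `r`-cone velocity law of a configuration is
pointwise nonnegative and at most `(3/(πr³)) M_{1,δ²,0}(0)` (restating `gC_nonneg`, `gC_le_Mg`).
[folklore] -/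
theorem stub_windowedEntropyBalanceC : ∀ (N : ℕ) (r δ : ℝ), 0 < r → 0 < δ →
    ∀ (w : Config (N + 1) (Fin 3) T3) (x : T3) (v : V3),
    0 ≤ ∫ q, 3 / (Real.pi * r ^ 3) * max (1 - Torus.euclidDist q.1 x / r) 0 *
        localMaxwellian 1 (δ ^ 2) (0 : V3) (v - q.2) ∂(empiricalMeasure w) ∧
    ∫ q, 3 / (Real.pi * r ^ 3) * max (1 - Torus.euclidDist q.1 x / r) 0 *
        localMaxwellian 1 (δ ^ 2) (0 : V3) (v - q.2) ∂(empiricalMeasure w) ≤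
      3 / (Real.pi * r ^ 3) * localMaxwellian 1 (δ ^ 2) (0 : V3) 0 :=
  fun _ _ _ hr hδ w x v => ⟨gC_nonneg hr hδ w x v, gC_le_Mg hr hδ w x v⟩

end Summit.AtomisticToContinuum.HydrodynamicLimit.Theorems.ChaosClosesEulerEntropyBalance

end
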